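/-
Copyright (c) 2026 the pub-hodgecm-mathlib formalisation cell (harness21).  Prover seat hodgecm-mathlib-F0P3a-p07 (g14): «S3-ram» seeding wave (LEAD F0P3a-plan (g12)
T11-88∕T11-90; owner F0P3a-p06 (g15)), (T2) G-side organ (Cnt2′), dictionary socket (F) «favourable class»; 2026-09-02.
-/
import Literature.NumberTheory.Rogawski1990.RamifiedPlaceNormSymbolDichotomy          -- ★ `hilbertSymbol_eq_one_iff_exists_norm_toPlace`; brings `hilbertSymbol_adicCompletion_mul_left`
import Literature.NumberTheory.Rogawski1990.FinExplicitTransferFactorDeepTauUniform       -- ★ `galAdicCompletionMap_det_mul_det_eq_one`, `…_trace_mul_det_eq`, `…_eval_charpoly_mul_eq`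
import Literature.NumberTheory.Rogawski1990.FinExplicitTransferFactorNondegenerate        -- ★ `isUnit_eval_finCharpolyTwo_of_isLocalGRegular`
import Literature.NumberTheory.Rogawski1990.UnitFundamentalLemmaInertFlickerFrame         -- ★ `isUnit_two_integer_iff_valued_eq_one`
import Literature.NumberTheory.LocalFields.RamifiedPlaceNormDictionary                    -- ★ `exists_mul_galAdicCompletionMap_eq_of_valued_sub_one_lt_one_of_ramified` (fixed principal units are norms)
import HarnessLib

/-!
# The «favourable class» of a type-(2) `γ_H` at a tame-ramified CM place: `c(γ_H) = det H′_w · χ_g(u)_w ∕ ((1+u_w)²·χ_g(−1)_w)` is a norm from `L_w` iff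
# `(y_λ, θ)_v · (β, θ)_v = 1` (Rogawski 1990 §4.9; Labesse–Langlands 1979 §2)

Topic `NumberTheory/Rogawski1990`; namespace `Literature.NumberTheory.Rogawski1990`.  THEOREMS ONLY (no definition, no named fact, no instance, no notation, no `sorry`).
Cell `pub/hodgecm-mathlib`, crux H413 (`--supports stmt-HodgeConjecture-24833`), «S3-ram» seeding wave (Literature seeding, count-neutral).  Socket (F) of the (Cnt2′) skeleton
(F0P3a-p07 (g14), chair line 2026-09-02T01:2xZ): the ONLY place of the type-(2) G-side count organ where Hilbert symbols occur.

THE MATHEMATICS.  For `γ_H = (g, u) ∈ H_v` near `1` (block `g_w ≡ 1`, `u_w ≡ 1 (mod ϖ_w²)`, `G`-regular) the row sockets of the (T2) G-side count laws are keyed on the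
literal-independent class `c(γ_H) := det H′_w · χ_g(u)_w ∕ ((1 + u_w)² · (1 + tr g_w + det g_w)) ∈ ι_w(L⁺_v)` (A-p19 (g27)'s (D2-γ) symmetrisation times `det H′_w`; F0P3a-p08
(g19)'s FAV), while the assembled socket (Cnt2′) speaks `(y_λ, θ)_v` (`ι_w y_λ = −det H′_w`) and `(β, θ)_v` (`ι_w β = −χ_g(u)_w (u_w² + det g_w) ∕ (2 u_w² det g_w)`, the T5
symmetrised discriminant).  The two currencies agree: `c(γ_H) = ι_w(y_λ) · ι_w(β) · ρ` with `ρ = 2u²D ∕ ((u² + D)(1 + u)²(1 + t + D))` (`t = tr g_w`, `D = det g_w`), and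
`16ρ = u² · D · ((u²+D)∕2)⁻¹ · ((1+u)²∕4)⁻¹ · ((1+t+D)∕4)⁻¹` is a `σ_w`-FIXED PRINCIPAL UNIT, hence a norm (★ `exists_mul_galAdicCompletionMap_eq_of_valued_sub_one_lt_one_of_ramified`);
so `c(γ_H)⁻¹ ∈ N(L_w^×) ⟺ y_λ·β ∈ N(L_w^×) ⟺ (y_λ β, θ)_v = 1 ⟺ (y_λ, θ)_v (β, θ)_v = 1` (★ `hilbertSymbol_eq_one_iff_exists_norm_toPlace`, ★ `hilbertSymbol_adicCompletion_mul_left`).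
* §0 two private valuation lemmas (principal units are closed under `·` and `⁻¹`).
* §1 **`exists_norm_mul_favourableClass_eq_one_iff_hilbertSymbol_mul_eq_one`** — the dictionary, keyed on the (Cnt2′) prefix (2-deep block and `u`-line, `G`-regular) and the
  two tokens `β`, `y_λ`.
HONEST LABEL: HC_CM is proved only modulo the 2 remaining named inputs (hLiu418 24832, h413 24833) until rung 0 closes; no books consequence.

## References
* [Rogawski1990] J. D. Rogawski, *Automorphic Representations of Unitary Groups in Three Variables*, Ann. of Math. Stud. 123 (1990), §4.9 Prop. 4.9.1 p. 55, Lemma 4.9.3 p. 56;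
  §4.3 (4.3.1)–(4.3.2) p. 43.
* [LabesseLanglands1979] J.-P. Labesse, R. P. Langlands, *L-indistinguishability for SL(2)*, Canad. J. Math. 31 (1979), §2 (2.1)–(2.2).
* [SerreLocalFields1979] J.-P. Serre, *Local Fields*, GTM 67 (1979), Ch. V §3 Cor. 2 (principal units and norms).
-/

set_option autoImplicit false

noncomputable section

open NumberField IsDedekindDomain Matrix Polynomial
open scoped MatrixGroups ValuativeRel WithZero

namespace Literature.NumberTheory.Rogawski1990

open Literature.NumberTheory.Automorphic Literature.NumberTheory.Automorphic.UnitaryGroup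
open Literature.NumberTheory.GaloisRepresentations Literature.NumberTheory.NumberFields Literature.NumberTheory.QuadraticForms

/-! ## §0 Principal units -/

section Principal

variable {K : Type*} [Field K] [Valued K (WithZero (Multiplicative ℤ))]

/-- `|x − 1| < 1 ⇒ |x| = 1`. [cite: SerreLocalFields1979, Ch. V §3] -/
private theorem v_eq_one_of_v_sub_one_lt {x : K} (hx : Valued.v (x - 1) < 1) : Valued.v x = 1 := by
  have h := Valuation.map_one_add_of_lt (Valued.v : Valuation K (WithZero (Multiplicative ℤ))) hx
  rwa [add_sub_cancel] at h

/-- Principal units are closed under products. [cite: SerreLocalFields1979, Ch. V §3] -/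
private theorem v_mul_sub_one_lt {x y : K} (hx : Valued.v (x - 1) < 1) (hy : Valued.v (y - 1) < 1) : Valued.v (x * y - 1) < 1 := by
  have hre : x * y - 1 = x * (y - 1) + (x - 1) := by ring
  rw [hre]
  refine lt_of_le_of_lt (Valuation.map_add _ _ _) (max_lt ?_ hx)
  rw [map_mul, v_eq_one_of_v_sub_one_lt hx, one_mul]; exact hy

/-- Principal units are closed under inverses. [cite: SerreLocalFields1979, Ch. V §3] -/
private theorem v_inv_sub_one_lt {x : K} (hx : Valued.v (x - 1) < 1) : Valued.v (x⁻¹ - 1) < 1 := by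
  have hx1 := v_eq_one_of_v_sub_one_lt hx
  have hx0 : x ≠ 0 := fun h => by rw [h, map_zero] at hx1; exact zero_ne_one hx1
  have hre : x⁻¹ - 1 = -(x⁻¹ * (x - 1)) := by field_simp; ring
  rw [hre, Valuation.map_neg, map_mul, map_inv₀, hx1, inv_one, one_mul]; exact hx

/-- `|x − a| < 1` with `|a| = 1`, `a ≠ 0` ⇒ `x ∕ a` is a principal unit. [cite: SerreLocalFields1979, Ch. V §3] -/
private theorem v_div_sub_one_lt {x a : K} (ha : Valued.v a = 1) (hx : Valued.v (x - a) < 1) : Valued.v (x / a - 1) < 1 := by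
  have ha0 : a ≠ 0 := fun h => by rw [h, map_zero] at ha; exact zero_ne_one ha
  have hre : x / a - 1 = (x - a) / a := by field_simp
  rw [hre, map_div₀, ha, div_one]; exact hx

end Principal

/-! ## §1 The dictionary -/

set_option maxHeartbeats 1600000 in
-- long statement (the (Cnt2′) prefix tokens) and a field computation with a dozen units
/-- **SOCKET (F) «FAVOURABLE CLASS» of the (Cnt2′) skeleton.**  At a non-split place `w ∣ v` RAMIFIED in `L` with `|2|_w = 1` and `H′_w` non-degenerate: for `γ_H = (g, u) ∈ H_v` with
`g_w ≡ 1` and `u_w ≡ 1 (mod ϖ_w²)`, `G`-regular, every symmetrised discriminant `β ∈ (L⁺_v)ˣ` (`ι_w β = −χ_g(u)_w (u_w² + det g_w) ∕ (2u_w² det g_w)`) and every `y_λ ∈ L⁺_v` with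
`ι_w y_λ = −det H′_w`:  **`(∃ z ∈ L_w, z · σ_w z · c(γ_H) = 1) ↔ (y_λ, θ)_v · (β, θ)_v = 1`** (product in `ℂ`), where `c(γ_H) = det H′_w · χ_g(u)_w ∕ ((1 + u_w)² (1 + tr g_w + det g_w))`.
[cite: Rogawski1990, §4.9 Prop. 4.9.1 p. 55, Lemma 4.9.3 p. 56; §4.3 (4.3.1) p. 43] [cite: LabesseLanglands1979, §2 (2.1)–(2.2)] [cite: SerreLocalFields1979, Ch. V §3 Cor. 2] -/
theorem exists_norm_mul_favourableClass_eq_one_iff_hilbertSymbol_mul_eq_one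
    (L : Type) [Field L] [NumberField L] [IsCMField L] (H' : Matrix (Fin 3) (Fin 3) L)
    {v : HeightOneSpectrum (𝓞 ↥(maximalRealSubfield L))} (w : PlacesOver L v)
    (hw : IsCMField.complexConj L • w.1 = w.1) (he : v.asIdeal.ramificationIdx' w.1.asIdeal ≠ 1)
    (hH'w : IsUnit (placeForm H' w.1)) (h2 : IsUnit (2 : 𝒪[(w.1.adicCompletion L)]))
    (ϖ : w.1.adicCompletion L) (hϖ : Valued.v ϖ = WithZero.exp (-1 : ℤ)) :
    ∀ ⦃γH : ((cmDatum L 2 (Matrix.of fun i j : Fin 2 => if i.val + j.val + 1 = 2 then (1 : L) else 0)).Local v ×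
        (cmDatum L 1 (Matrix.of fun i j : Fin 1 => if i.val + j.val + 1 = 1 then (1 : L) else 0)).Local v)⦄,
      (∀ i j : Fin 2, Valued.v (((((γH.1.val : GL (Fin 2) (UnitaryGroup.LocalRing L v)).val.map
          (Pi.evalRingHom (fun w' : PlacesOver L v => w'.1.adicCompletion L) w))) - 1) i j) ≤ Valued.v (ϖ ^ 2)) →
      Valued.v (finGammaTwo L v γH w - 1) ≤ Valued.v (ϖ ^ 2) → IsLocalGRegular L v γH →
      ∀ β : (v.adicCompletion ↥(maximalRealSubfield L))ˣ,
        toPlace v w (β : v.adicCompletion ↥(maximalRealSubfield L)) =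
          -(((finCharpolyTwo L v γH).eval (finGammaTwo L v γH)) w *
              (finGammaTwo L v γH w ^ 2 +
                ((γH.1.val.val : Matrix (Fin 2) (Fin 2) (LocalRing L v)).map (Pi.evalRingHom (fun w' : PlacesOver L v => w'.1.adicCompletion L) w)).det)) /
            (2 * finGammaTwo L v γH w ^ 2 *
              ((γH.1.val.val : Matrix (Fin 2) (Fin 2) (LocalRing L v)).map (Pi.evalRingHom (fun w' : PlacesOver L v => w'.1.adicCompletion L) w)).det) →
      ∀ yl : v.adicCompletion ↥(maximalRealSubfield L), toPlace v w yl = -(placeForm H' w.1).det →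
      ((∃ z : w.1.adicCompletion L, z * galAdicCompletionMap (L := L) (IsCMField.complexConj L) hw z *
          ((placeForm H' w.1).det * ((finCharpolyTwo L v γH).eval (finGammaTwo L v γH)) w /
            ((1 + finGammaTwo L v γH w) ^ 2 *
              (1 + ((γH.1.val.val : Matrix (Fin 2) (Fin 2) (LocalRing L v)).map (Pi.evalRingHom (fun w' : PlacesOver L v => w'.1.adicCompletion L) w)).trace +
                ((γH.1.val.val : Matrix (Fin 2) (Fin 2) (LocalRing L v)).map (Pi.evalRingHom (fun w' : PlacesOver L v => w'.1.adicCompletion L) w)).det))) = 1) ↔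
        (hilbertSymbol (v.adicCompletion ↥(maximalRealSubfield L)) yl
            (algebraMap ↥(maximalRealSubfield L) _ ((cmQuadraticGenerator L : 𝓞 ↥(maximalRealSubfield L)) : ↥(maximalRealSubfield L))) : ℂ) *
          (hilbertSymbol (v.adicCompletion ↥(maximalRealSubfield L)) (β : v.adicCompletion ↥(maximalRealSubfield L))
            (algebraMap ↥(maximalRealSubfield L) _ ((cmQuadraticGenerator L : 𝓞 ↥(maximalRealSubfield L)) : ↥(maximalRealSubfield L))) : ℂ) = 1) := by
  intro γH hblk hu2 hreg β hβ yl hyl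
  classical
  haveI : Algebra.IsQuadraticExtension ↥(maximalRealSubfield L) L := IsCMField.isQuadraticExtension L
  haveI : CharZero (v.adicCompletion ↥(maximalRealSubfield L)) :=
    charZero_of_injective_algebraMap (algebraMap ↥(maximalRealSubfield L) (v.adicCompletion ↥(maximalRealSubfield L))).injective
  have hc1 : IsCMField.complexConj L ≠ 1 := IsCMField.complexConj_ne_one L
  set σ := galAdicCompletionMap (L := L) (IsCMField.complexConj L) hw with hσdef
  set u := finGammaTwo L v γH w with hudef
  set χu := ((finCharpolyTwo L v γH).eval (finGammaTwo L v γH)) w with hχudef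
  set g : Matrix (Fin 2) (Fin 2) (w.1.adicCompletion L) :=
    ((γH.1.val.val : Matrix (Fin 2) (Fin 2) (LocalRing L v)).map (Pi.evalRingHom (fun w' : PlacesOver L v => w'.1.adicCompletion L) w)) with hgdef
  set D := g.det with hDdef
  set t := g.trace with htdef
  set θ : v.adicCompletion ↥(maximalRealSubfield L) :=
    algebraMap ↥(maximalRealSubfield L) _ ((cmQuadraticGenerator L : 𝓞 ↥(maximalRealSubfield L)) : ↥(maximalRealSubfield L)) with hθdef
  have hθ0 : θ ≠ 0 := by
    rw [hθdef, Ne, map_eq_zero_iff _ (algebraMap ↥(maximalRealSubfield L) (v.adicCompletion ↥(maximalRealSubfield L))).injective]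
    exact fun h => not_isSquare_cmQuadraticGenerator L (by rw [h]; exact IsSquare.zero)
  -- |2| = 1, |ϖ²| < 1
  have h2v : Valued.v (2 : w.1.adicCompletion L) = 1 := (isUnit_two_integer_iff_valued_eq_one L w.1).1 h2
  have h20 : (2 : w.1.adicCompletion L) ≠ 0 := fun h0 => by rw [h0, map_zero] at h2v; exact zero_ne_one h2v
  have h4v : Valued.v (4 : w.1.adicCompletion L) = 1 := by
    rw [show (4 : w.1.adicCompletion L) = 2 * 2 by norm_num, map_mul, h2v, one_mul]
  have hϖ2 : Valued.v (ϖ ^ 2) < 1 := by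
    rw [map_pow, hϖ, ← WithZero.exp_nsmul, ← WithZero.exp_zero, WithZero.exp_lt_exp]; norm_num
  -- principal units: `u`, `D`, `t∕2`-type quantities
  have hu1 : Valued.v (u - 1) < 1 := lt_of_le_of_lt hu2 hϖ2
  have hvu : Valued.v u = 1 := v_eq_one_of_v_sub_one_lt hu1
  have hu0 : u ≠ 0 := fun h0 => by rw [h0, map_zero] at hvu; exact zero_ne_one hvu
  have hent : ∀ i j : Fin 2, Valued.v (g i j - (1 : Matrix (Fin 2) (Fin 2) (w.1.adicCompletion L)) i j) < 1 := fun i j => by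
    have h := hblk i j
    rw [Matrix.sub_apply] at h
    exact lt_of_le_of_lt h hϖ2
  have h00 : Valued.v (g 0 0 - 1) < 1 := by simpa using hent 0 0
  have h11 : Valued.v (g 1 1 - 1) < 1 := by simpa using hent 1 1
  have h01 : Valued.v (g 0 1) < 1 := by simpa using hent 0 1
  have h10 : Valued.v (g 1 0) < 1 := by simpa using hent 1 0
  have hD1 : Valued.v (D - 1) < 1 := by
    have hre : D - 1 = (g 0 0 - 1) * (g 1 1 - 1) + (g 0 0 - 1) + (g 1 1 - 1) - g 0 1 * g 1 0 := by
      rw [hDdef, Matrix.det_fin_two]; ring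
    rw [hre]
    refine lt_of_le_of_lt (Valuation.map_sub _ _ _) (max_lt ?_ ?_)
    · refine lt_of_le_of_lt (Valuation.map_add _ _ _) (max_lt ?_ h11)
      refine lt_of_le_of_lt (Valuation.map_add _ _ _) (max_lt ?_ h00)
      rw [map_mul]; exact mul_lt_one_of_nonneg_of_lt_one_left zero_le h00 h11.le
    · rw [map_mul]; exact mul_lt_one_of_nonneg_of_lt_one_left zero_le h01 h10.le
  have hvD : Valued.v D = 1 := v_eq_one_of_v_sub_one_lt hD1
  have hD0 : D ≠ 0 := fun h0 => by rw [h0, map_zero] at hvD; exact zero_ne_one hvD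
  have ht2 : Valued.v (t - 2) < 1 := by
    have hre : t - 2 = (g 0 0 - 1) + (g 1 1 - 1) := by rw [htdef, Matrix.trace_fin_two]; ring
    rw [hre]; exact lt_of_le_of_lt (Valuation.map_add _ _ _) (max_lt h00 h11)
  -- the three bracket units
  have hA : Valued.v ((u ^ 2 + D) / 2 - 1) < 1 := by
    refine v_div_sub_one_lt h2v ?_
    have hre : u ^ 2 + D - 2 = (u - 1) * (u + 1) + (D - 1) := by ring
    rw [hre]
    refine lt_of_le_of_lt (Valuation.map_add _ _ _) (max_lt ?_ hD1)
    rw [map_mul]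
    refine mul_lt_one_of_nonneg_of_lt_one_left zero_le hu1 ?_
    exact (Valuation.map_add _ _ _).trans (max_le hvu.le (le_of_eq (map_one _)))
  have hB : Valued.v ((1 + u) ^ 2 / 4 - 1) < 1 := by
    have hre : (1 + u) ^ 2 / 4 = ((1 + u) / 2) * ((1 + u) / 2) := by field_simp; norm_num
    rw [hre]
    have h1 : Valued.v ((1 + u) / 2 - 1) < 1 := by
      refine v_div_sub_one_lt h2v ?_
      have hre' : 1 + u - 2 = u - 1 := by ring
      rw [hre']; exact hu1
    exact v_mul_sub_one_lt h1 h1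
  have hC : Valued.v ((1 + t + D) / 4 - 1) < 1 := by
    refine v_div_sub_one_lt h4v ?_
    have hre : 1 + t + D - 4 = (t - 2) + (D - 1) := by ring
    rw [hre]; exact lt_of_le_of_lt (Valuation.map_add _ _ _) (max_lt ht2 hD1)
  have hu2' : Valued.v (u ^ 2 - 1) < 1 := by
    have hre : u ^ 2 = u * u := sq u
    rw [hre]; exact v_mul_sub_one_lt hu1 hu1
  -- non-vanishing of the brackets
  have hA0 : u ^ 2 + D ≠ 0 := by
    intro h0
    have h := v_eq_one_of_v_sub_one_lt hA
    rw [h0, zero_div, map_zero] at h; exact zero_ne_one h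
  have hB0 : (1 + u) ≠ 0 := by
    intro h0
    have h := v_eq_one_of_v_sub_one_lt hB
    rw [h0, zero_pow two_ne_zero, zero_div, map_zero] at h; exact zero_ne_one h
  have hC0 : 1 + t + D ≠ 0 := by
    intro h0
    have h := v_eq_one_of_v_sub_one_lt hC
    rw [h0, zero_div, map_zero] at h; exact zero_ne_one h
  -- `ρ″ := 16ρ` is a principal unit
  set ρ'' : w.1.adicCompletion L := u ^ 2 * D * ((u ^ 2 + D) / 2)⁻¹ * ((1 + u) ^ 2 / 4)⁻¹ * ((1 + t + D) / 4)⁻¹ with hρdef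
  have hρ1 : Valued.v (ρ'' - 1) < 1 :=
    v_mul_sub_one_lt (v_mul_sub_one_lt (v_mul_sub_one_lt (v_mul_sub_one_lt hu2' hD1) (v_inv_sub_one_lt hA)) (v_inv_sub_one_lt hB)) (v_inv_sub_one_lt hC)
  -- σ-relations
  have hσu : σ u * u = 1 := by
    have h := congrArg (fun y : LocalRing L v => y w) (conjLocal_finGammaTwo_mul_finGammaTwo L v γH)
    simpa only [Pi.mul_apply, Pi.one_apply, conjLocal_apply_eq_galAdicCompletionMap L v w hw] using h
  have hσD : σ D * D = 1 := galAdicCompletionMap_det_mul_det_eq_one L v w hw γH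
  have hσt : σ t * D = t := galAdicCompletionMap_trace_mul_det_eq L v w hw γH
  have hσu' : σ u = u⁻¹ := eq_inv_of_mul_eq_one_left hσu
  have hσD' : σ D = D⁻¹ := eq_inv_of_mul_eq_one_left hσD
  have hσt' : σ t = t / D := by rw [eq_div_iff hD0]; exact hσt
  have hσρ : σ ρ'' = ρ'' := by
    have hA' : (u⁻¹) ^ 2 + D⁻¹ = (u ^ 2 + D) / (u ^ 2 * D) := by field_simp; ring
    have hB' : (1 + u⁻¹) ^ 2 = (1 + u) ^ 2 / u ^ 2 := by field_simp; ring
    have hC' : 1 + t / D + D⁻¹ = (1 + t + D) / D := by field_simp; ring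
    rw [hρdef]
    simp only [map_mul, map_inv₀, map_div₀, map_add, map_pow, map_one, map_ofNat, hσu', hσD', hσt']
    rw [hA', hB', hC']
    field_simp
  -- `ρ″` is a norm
  obtain ⟨z₁, hz₁⟩ := Literature.NumberTheory.LocalFields.RamifiedPlaceNormDictionary.exists_mul_galAdicCompletionMap_eq_of_valued_sub_one_lt_one_of_ramified
    L (IsCMField.complexConj L) hc1 v w hw he h2v hσρ hρ1
  rw [← hσdef] at hz₁
  have hρ0 : ρ'' ≠ 0 := fun h0 => by
    have h := v_eq_one_of_v_sub_one_lt hρ1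
    rw [h0, map_zero] at h; exact zero_ne_one h
  have hz₁0 : z₁ ≠ 0 := by rintro rfl; rw [zero_mul] at hz₁; exact hρ0 hz₁.symm
  -- `χ_g(u) ≠ 0`, `det H′_w ≠ 0`, `y_λ ≠ 0`, `β ≠ 0`
  have hχ0 : χu ≠ 0 :=
    ((isUnit_eval_finCharpolyTwo_of_isLocalGRegular L v γH hreg).map (Pi.evalRingHom (fun w' : PlacesOver L v => w'.1.adicCompletion L) w)).ne_zero
  have hdet0 : (placeForm H' w.1).det ≠ 0 := ((Matrix.isUnit_iff_isUnit_det _).1 hH'w).ne_zero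
  have hyl0 : yl ≠ 0 := by
    intro h0; rw [h0, map_zero, eq_comm, neg_eq_zero] at hyl; exact hdet0 hyl
  have hβ0 : (β : v.adicCompletion ↥(maximalRealSubfield L)) ≠ 0 := β.ne_zero
  have hY0 : yl * (β : v.adicCompletion ↥(maximalRealSubfield L)) ≠ 0 := mul_ne_zero hyl0 hβ0
  -- the identity `c = ι(y_λ)·ι(β)·ρ″∕16`
  have h16 : (16 : w.1.adicCompletion L) ≠ 0 := by
    rw [show (16 : w.1.adicCompletion L) = 2 * 2 * (2 * 2) by norm_num]; exact mul_ne_zero (mul_ne_zero h20 h20) (mul_ne_zero h20 h20)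
  have hc : (placeForm H' w.1).det * χu / ((1 + u) ^ 2 * (1 + t + D)) = toPlace v w yl * toPlace v w (β : v.adicCompletion ↥(maximalRealSubfield L)) * (ρ'' / 16) := by
    rw [hyl, hβ, hρdef]
    field_simp
    ring
  have hcN : (placeForm H' w.1).det * χu / ((1 + u) ^ 2 * (1 + t + D)) =
      toPlace v w (yl * (β : v.adicCompletion ↥(maximalRealSubfield L))) * ((z₁ / 4) * σ (z₁ / 4)) := by
    rw [hc, map_mul, map_div₀, map_ofNat, ← hz₁]
    field_simp
    ring
  have hz₄0 : z₁ / 4 ≠ 0 := div_ne_zero hz₁0 (by rw [show (4 : w.1.adicCompletion L) = 2 * 2 by norm_num]; exact mul_ne_zero h20 h20)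
  have hσσ : ∀ y, σ (σ y) = y := fun y => galAdicCompletionMap_galAdicCompletionMap_of_smul_eq (IsCMField.complexConj L) w hc1 hw y
  -- STEP 1: the norm condition on `c` ⟺ `ι(y_λ β)` is a norm
  have step1 : (∃ z : w.1.adicCompletion L, z * σ z * ((placeForm H' w.1).det * χu / ((1 + u) ^ 2 * (1 + t + D))) = 1) ↔
      ∃ y : w.1.adicCompletion L, σ y * y = toPlace v w (yl * (β : v.adicCompletion ↥(maximalRealSubfield L))) := by
    rw [hcN]
    constructor
    · rintro ⟨z, hz⟩
      have hz0 : z ≠ 0 := by rintro rfl; rw [zero_mul, zero_mul] at hz; exact zero_ne_one hz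
      refine ⟨(z * (z₁ / 4))⁻¹, ?_⟩
      rw [map_inv₀, map_mul]
      have hne : z * (z₁ / 4) * (σ z * σ (z₁ / 4)) ≠ 0 := by
        refine mul_ne_zero (mul_ne_zero hz0 hz₄0) (mul_ne_zero ?_ ?_)
        · intro h0; exact hz0 (by rw [← hσσ z, h0, map_zero])
        · intro h0; exact hz₄0 (by rw [← hσσ (z₁ / 4), h0, map_zero])
      -- `hz : z σz · (Y · (z₄ σ z₄)) = 1` ⇒ `Y = (σ(z z₄) · (z z₄))⁻¹`
      have hzz : (z * (z₁ / 4)) * (σ z * σ (z₁ / 4)) ≠ 0 := hne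
      have hY : toPlace v w (yl * (β : v.adicCompletion ↥(maximalRealSubfield L))) = ((z * (z₁ / 4)) * (σ z * σ (z₁ / 4)))⁻¹ :=
        eq_inv_of_mul_eq_one_left (by rw [← hz]; ring)
      rw [hY, mul_inv, mul_inv, mul_inv, mul_inv]
      ring
    · rintro ⟨y, hy⟩
      have hT0 : toPlace v w (yl * (β : v.adicCompletion ↥(maximalRealSubfield L))) ≠ 0 := by
        exact (_root_.map_ne_zero (toPlace v w)).2 hY0
      have hy0 : y ≠ 0 := by rintro rfl; rw [mul_zero] at hy; exact hT0 hy.symm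
      have hσy0 : σ y ≠ 0 := fun h0 => hy0 (by rw [← hσσ y, h0, map_zero])
      refine ⟨(y * (z₁ / 4))⁻¹, ?_⟩
      rw [← hy, map_inv₀, map_mul]
      have hne : y * (z₁ / 4) * (σ y * σ (z₁ / 4)) ≠ 0 :=
        mul_ne_zero (mul_ne_zero hy0 hz₄0) (mul_ne_zero hσy0 (fun h0 => hz₄0 (by rw [← hσσ (z₁ / 4), h0, map_zero])))
      have hre : (y * (z₁ / 4))⁻¹ * (σ y * σ (z₁ / 4))⁻¹ * (σ y * y * (z₁ / 4 * σ (z₁ / 4))) =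
          (y * (z₁ / 4) * (σ y * σ (z₁ / 4)))⁻¹ * (y * (z₁ / 4) * (σ y * σ (z₁ / 4))) := by
        rw [mul_inv]; ring
      rw [hre, inv_mul_cancel₀ hne]
  -- STEP 2: norm reading and multiplicativity of the symbol
  rw [step1, ← hilbertSymbol_eq_one_iff_exists_norm_toPlace L v w hw hY0,
    hilbertSymbol_adicCompletion_mul_left ↥(maximalRealSubfield L) v hyl0 hβ0 hθ0]
  constructor
  · intro h; exact_mod_cast h
  · intro h; exact_mod_cast h

end Literature.NumberTheory.Rogawski1990
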